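import Summits.Ventures.PercRepro.ProfilePointedAvoidRowUpset
import Summits.Ventures.PercRepro.ProfilePointedMirror

/-!
# PercRepro — THE TWO UP-SET MASTER STATEMENTS (D-gen) AND (H-gen) COINCIDE AT THE MIDDLE LEVEL OF AN ODD GROUND SET
(p10, gen 26)

For a finite matroid `M` on `n` elements and an up-set `U` of its flats, gen 25's (D-gen) at level `k` reads
`(n − k)·F_k ≤ (k + 1)·F_{k+1}` with `F_k = avoidUpCount M U k = #{X ∈ BI_k : cl(E ∖ X) ∉ U}`, and gen 26's (H-gen) at level `k`
(ProfilePointedMirrorUpset, `SepMirror`) reads, in its closure form, `u_k ≤ u_{n−k}` with `u_k = #{X ∈ BI_k : cl X ∈ U}`.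
Complementation gives `F_k + u_{n−k} = P_k` (`avoidUpCount_add_card_filter_clF_mem_mirror`).  At the middle level of an ODD
ground set, `n = 2k + 1`, where `P_k = P_{k+1}` and `n − k = k + 1`, the two statements are THE SAME inequality `u_k ≤ u_{k+1}`
(`avoidRowUpset_level_iff_mirror_level_of_mid`) — the up-set form of the pointed coincidence (H)_k ⟺ (D)_k at `2k + 2 = N`
(ProfilePointedMirrorLimit), which is its instance at a modular cut.  Nothing here asserts (D-gen), (H-gen), (D) or (H).
-/

open scoped Matroid

namespace PercRepro.Cogirth

open Finset ThmH Skew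

variable {α : Type} [DecidableEq α] {M : Matroid α} [M.Finite]

/-- `#{X ∈ BI_k : cl(E ∖ X) ∈ U} = #{X ∈ BI_{n−k} : cl X ∈ U}` (complementation). -/
theorem card_filter_clF_sdiff_mem_eq_mirror (U : Finset (Finset α)) {k : ℕ} (hk : k ≤ (gr M).card) :
    ((biIndepSets M k).filter (fun X => clF M (gr M \ X) ∈ U)).card =
      ((biIndepSets M ((gr M).card - k)).filter (fun X => clF M X ∈ U)).card := by
  apply card_bij (fun Z _ => gr M \ Z)
  · intro Z hZ
    rw [mem_filter] at hZ ⊢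
    exact ⟨sdiff_mem_biIndepSets hZ.1, hZ.2⟩
  · intro Z₁ hZ₁ Z₂ hZ₂ heq
    rw [mem_filter] at hZ₁ hZ₂
    have h₁ : Z₁ ⊆ gr M := (mem_biIndepSets.1 hZ₁.1).1
    have h₂ : Z₂ ⊆ gr M := (mem_biIndepSets.1 hZ₂.1).1
    rw [← Finset.sdiff_sdiff_eq_self h₁, ← Finset.sdiff_sdiff_eq_self h₂, heq]
  · intro Y hY
    rw [mem_filter] at hY
    have hYg : Y ⊆ gr M := (mem_biIndepSets.1 hY.1).1
    refine ⟨gr M \ Y, ?_, Finset.sdiff_sdiff_eq_self hYg⟩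
    rw [mem_filter]
    refine ⟨?_, ?_⟩
    · have := sdiff_mem_biIndepSets hY.1
      rwa [show (gr M).card - ((gr M).card - k) = k by omega] at this
    · rw [Finset.sdiff_sdiff_eq_self hYg]
      exact hY.2

/-- **`F_k + u_{n−k} = P_k`**: a bi-independent `k`-set either has its complement's closure outside `U` (counted by
(D-gen)'s `F_k`) or inside it (counted, through complementation, by (H-gen)'s `u_{n−k}`). -/
theorem avoidUpCount_add_card_filter_clF_mem_mirror (U : Finset (Finset α)) {k : ℕ} (hk : k ≤ (gr M).card) :
    avoidUpCount M U k + ((biIndepSets M ((gr M).card - k)).filter (fun X => clF M X ∈ U)).card =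
      (biIndepSets M k).card := by
  rw [← card_filter_clF_sdiff_mem_eq_mirror U hk]
  unfold avoidUpCount
  have h := card_filter_add_card_filter_not (s := biIndepSets M k) (fun X => clF M (gr M \ X) ∈ U)
  rw [add_comm] at h
  exact h

/-- **AT THE MIDDLE LEVEL OF AN ODD GROUND SET, (D-gen) AND (H-gen) ARE THE SAME INEQUALITY** `u_k ≤ u_{k+1}`
(`n = 2k + 1`, `U` any family of flats; unconditional). -/
theorem avoidRowUpset_level_iff_mirror_level_of_mid (U : Finset (Finset α)) {k : ℕ}
    (hk : 2 * k + 1 = (gr M).card) :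
    ((gr M).card - k) * avoidUpCount M U k ≤ (k + 1) * avoidUpCount M U (k + 1) ↔
      ((biIndepSets M k).filter (fun X => clF M X ∈ U)).card ≤
        ((biIndepSets M ((gr M).card - k)).filter (fun X => clF M X ∈ U)).card := by
  have hP := card_biIndepSets_symm M (k := k) (by omega)
  have h1 := avoidUpCount_add_card_filter_clF_mem_mirror (M := M) U (k := k) (by omega)
  have h2 := avoidUpCount_add_card_filter_clF_mem_mirror (M := M) U (k := k + 1) (by omega)
  rw [show (gr M).card - k = k + 1 by omega] at hP h1 ⊢
  rw [show (gr M).card - (k + 1) = k by omega] at h2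
  constructor
  · intro h
    have := Nat.le_of_mul_le_mul_left h (Nat.succ_pos k)
    omega
  · intro h
    exact Nat.mul_le_mul_left _ (by omega)

end PercRepro.Cogirth
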